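import Literature.MathematicalPhysics.KineticTheory.HardSphereEuler
import Literature.Geometry.GeometricMeasureTheory.VarifoldLimit
import Mathlib.MeasureTheory.Measure.TightNormed
import Mathlib.Topology.MetricSpace.Sequences
import HarnessLib

/-!
# Quantitative Maxwellian rigidity by compactness — A: tightness and subsequence extraction

Helper for the line `Sketch` of the crux `InformationPercolationEngine.ChaosClosesEuler`
(stmt-AtomisticToContinuum-15141), registered stub `stub_quantitativeRigidity`.

Pure measure theory on `V3 = ℝ³`:

* `setIntegral_sq_tail_anti` — the second-moment tail `L ↦ ∫_{L<|v|} |v|² dm` is non-increasing;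
* `tendsto_setIntegral_sq_tail_zero` — it tends to `0` along `L = k → ∞` when `|v|²` is integrable;
* `exists_ui_of_tail_schedule` — a sequence `mₙ` obeying the tail schedule
  `∫_{Lt j<|v|} |v|² dmₙ ≤ 1/(j+1)` for `j ≤ n` has uniformly integrable second moments (the finitely
  many `n < j` are absorbed by their own integrable tails);
* `isTightMeasureSet_of_ui` — uniformly integrable second moments make a sequence of finite measures
  tight (Chebyshev on the complement of a closed ball);
* `exists_subseq_tendsto_of_isTight` — a tight sequence of finite measures with masses in a window
  `[ρ₁, ρ₂]`, `ρ₁ > 0`, has a weakly convergent subsequence (Bolzano–Weierstrass on the masses, then the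
  tree's `exists_subseq_tendsto_of_isTightMeasureSet`, i.e. Prokhorov via normalisation);
* `exists_subseq_tendsto_of_mass_le_of_tail` — the packaged extraction used by the stub: mass window +
  tail schedule ⇒ weakly convergent subsequence with uniformly integrable second moments.

References: P. Billingsley, *Convergence of Probability Measures*, 2nd ed. (1999), §5 (Prokhorov).
-/

noncomputable section

namespace Summit.AtomisticToContinuum.HydrodynamicLimit.Theorems.ChaosClosesEulerQuantitativeRigidity

open scoped BigOperators Topology Classical MeasureTheory ENNReal NNReal
open Filter Set MeasureTheory
open Literature.MathematicalPhysics.KineticTheory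

/-- The second-moment tail `∫_{L<|v|} |v|² dm` is non-increasing in the level `L`. [folklore] -/
theorem setIntegral_sq_tail_anti {m : Measure V3} (h2 : Integrable (fun v : V3 => ‖v‖ ^ 2) m)
    {L L' : ℝ} (hL : L ≤ L') :
    ∫ v in {v : V3 | L' < ‖v‖}, ‖v‖ ^ 2 ∂m ≤ ∫ v in {v : V3 | L < ‖v‖}, ‖v‖ ^ 2 ∂m :=
  setIntegral_mono_set h2.integrableOn (Eventually.of_forall fun v => sq_nonneg ‖v‖)
    (LE.le.eventuallyLE (show {v : V3 | L' < ‖v‖} ≤ {v : V3 | L < ‖v‖} from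
      fun v (hv : L' < ‖v‖) => hL.trans_lt hv))

/-- If `|v|²` is integrable, its tails `∫_{k<|v|} |v|² dm` tend to `0` as `k → ∞`. [folklore] -/
theorem tendsto_setIntegral_sq_tail_zero {m : Measure V3} (h2 : Integrable (fun v : V3 => ‖v‖ ^ 2) m) :
    Tendsto (fun k : ℕ => ∫ v in {v : V3 | (k : ℝ) < ‖v‖}, ‖v‖ ^ 2 ∂m) atTop (𝓝 0) := by
  have hmeas : ∀ k : ℕ, MeasurableSet {v : V3 | (k : ℝ) < ‖v‖} := fun k =>
    measurableSet_lt measurable_const measurable_norm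
  have hanti : Antitone fun k : ℕ => {v : V3 | (k : ℝ) < ‖v‖} :=
    fun k k' hkk' v (hv : (k' : ℝ) < ‖v‖) => lt_of_le_of_lt (Nat.cast_le.2 hkk') hv
  have h := tendsto_setIntegral_of_antitone hmeas hanti ⟨0, h2.integrableOn⟩
  have hempty : (⋂ k : ℕ, {v : V3 | (k : ℝ) < ‖v‖}) = ∅ := by
    ext v
    simp only [mem_iInter, mem_setOf_eq, mem_empty_iff_false, iff_false, not_forall, not_lt]
    exact ⟨⌈‖v‖⌉₊, Nat.le_ceil _⟩
  rw [hempty, Measure.restrict_empty, integral_zero_measure] at h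
  exact h

/-- **Tail schedule ⇒ uniform integrability.** If every `mₙ` has `|v|²` integrable and obeys
`∫_{Lt j<|v|} |v|² dmₙ ≤ 1/(j+1)` for all `j ≤ n`, then the second moments of `(mₙ)` are uniformly
integrable: for every `ε > 0` one level `L` works for all `n`. [folklore] -/
theorem exists_ui_of_tail_schedule {m : ℕ → Measure V3}
    (h2 : ∀ n, Integrable (fun v : V3 => ‖v‖ ^ 2) (m n)) (Lt : ℕ → ℝ)
    (htail : ∀ n j : ℕ, j ≤ n →
      ∫ v in {v : V3 | Lt j < ‖v‖}, ‖v‖ ^ 2 ∂(m n) ≤ 1 / ((j : ℝ) + 1))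
    {ε : ℝ} (hε : 0 < ε) :
    ∃ L : ℝ, ∀ n, ∫ v in {v : V3 | L < ‖v‖}, ‖v‖ ^ 2 ∂(m n) ≤ ε := by
  obtain ⟨j, hj⟩ := exists_nat_one_div_lt hε
  have hk : ∀ n, ∃ k : ℕ, ∫ v in {v : V3 | (k : ℝ) < ‖v‖}, ‖v‖ ^ 2 ∂(m n) ≤ ε := fun n => by
    obtain ⟨k, hk⟩ := ((tendsto_order.1 (tendsto_setIntegral_sq_tail_zero (h2 n))).2 ε hε).exists
    exact ⟨k, hk.le⟩
  choose k hk using hk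
  refine ⟨max (Lt j) (((Finset.range j).sup k : ℕ) : ℝ), fun n => ?_⟩
  rcases le_or_gt j n with hjn | hnj
  · calc ∫ v in {v : V3 | max (Lt j) (((Finset.range j).sup k : ℕ) : ℝ) < ‖v‖}, ‖v‖ ^ 2 ∂(m n)
        ≤ ∫ v in {v : V3 | Lt j < ‖v‖}, ‖v‖ ^ 2 ∂(m n) := setIntegral_sq_tail_anti (h2 n) (le_max_left _ _)
      _ ≤ 1 / ((j : ℝ) + 1) := htail n j hjn
      _ ≤ ε := hj.le
  · have hkn : ((k n : ℕ) : ℝ) ≤ max (Lt j) (((Finset.range j).sup k : ℕ) : ℝ) :=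
      le_max_of_le_right (Nat.cast_le.2 (Finset.le_sup (f := k) (Finset.mem_range.2 hnj)))
    exact (setIntegral_sq_tail_anti (h2 n) hkn).trans (hk n)

/-- **Uniformly integrable second moments ⇒ tightness** for a sequence of finite measures on `ℝ³`
(Chebyshev: `m {R<|v|} ≤ ∫_{R<|v|} |v|²` for `R ≥ 1`). [folklore] -/
theorem isTightMeasureSet_of_ui {m : ℕ → Measure V3} [∀ n, IsFiniteMeasure (m n)]
    (h2 : ∀ n, Integrable (fun v : V3 => ‖v‖ ^ 2) (m n))
    (hUI : ∀ ε : ℝ, 0 < ε → ∃ L : ℝ, ∀ n, ∫ v in {v : V3 | L < ‖v‖}, ‖v‖ ^ 2 ∂(m n) ≤ ε) :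
    IsTightMeasureSet (Set.range m) := by
  rw [isTightMeasureSet_iff_exists_isCompact_measure_compl_le]
  intro ε hε
  rcases eq_or_ne ε ⊤ with rfl | hεtop
  · exact ⟨∅, isCompact_empty, fun μ _ => le_top⟩
  have hε' : 0 < ε.toReal := ENNReal.toReal_pos hε.ne' hεtop
  obtain ⟨L, hL⟩ := hUI ε.toReal hε'
  refine ⟨Metric.closedBall (0 : V3) (max L 1), isCompact_closedBall _ _, ?_⟩
  rintro _ ⟨n, rfl⟩
  have hset : (Metric.closedBall (0 : V3) (max L 1))ᶜ = {v : V3 | max L 1 < ‖v‖} := by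
    ext v
    simp only [mem_compl_iff, Metric.mem_closedBall, dist_zero_right, not_le, mem_setOf_eq]
  rw [hset]
  have hSm : MeasurableSet {v : V3 | max L 1 < ‖v‖} := measurableSet_lt measurable_const measurable_norm
  have h1 : (m n).real {v : V3 | max L 1 < ‖v‖} ≤ ∫ v in {v : V3 | max L 1 < ‖v‖}, ‖v‖ ^ 2 ∂(m n) := by
    have h0 : (m n).real {v : V3 | max L 1 < ‖v‖} = ∫ v in {v : V3 | max L 1 < ‖v‖}, (1 : ℝ) ∂(m n) := by
      rw [setIntegral_const, smul_eq_mul, mul_one]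
    rw [h0]
    refine setIntegral_mono_on (integrable_const _).integrableOn (h2 n).integrableOn hSm fun v hv => ?_
    have hv1 : 1 ≤ ‖v‖ := ((le_max_right L 1).trans_lt hv).le
    exact one_le_pow₀ hv1
  have h3 : ∫ v in {v : V3 | max L 1 < ‖v‖}, ‖v‖ ^ 2 ∂(m n) ≤ ε.toReal :=
    (setIntegral_sq_tail_anti (h2 n) (le_max_left _ _)).trans (hL n)
  calc (m n) {v : V3 | max L 1 < ‖v‖} = ENNReal.ofReal ((m n).real {v : V3 | max L 1 < ‖v‖}) :=
        (ofReal_measureReal (measure_ne_top _ _)).symm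
    _ ≤ ENNReal.ofReal ε.toReal := ENNReal.ofReal_le_ofReal (h1.trans h3)
    _ = ε := ENNReal.ofReal_toReal hεtop

/-- **Subsequence extraction.** A tight sequence of finite measures on `ℝ³` with masses in a window
`[ρ₁, ρ₂]`, `ρ₁ > 0`, has a weakly convergent subsequence (Bolzano–Weierstrass on the masses, then
Prokhorov via normalisation, `exists_subseq_tendsto_of_isTightMeasureSet`). [folklore] -/
theorem exists_subseq_tendsto_of_isTight {μs : ℕ → FiniteMeasure V3}
    (htight : IsTightMeasureSet (Set.range fun n => (μs n : Measure V3))) {ρ₁ ρ₂ : ℝ}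
    (hρ₁ : 0 < ρ₁) (hm1 : ∀ n, ρ₁ ≤ ((μs n : Measure V3) univ).toReal)
    (hm2 : ∀ n, ((μs n : Measure V3) univ).toReal ≤ ρ₂) :
    ∃ φ : ℕ → ℕ, StrictMono φ ∧ ∃ μ : FiniteMeasure V3, Tendsto (μs ∘ φ) atTop (𝓝 μ) := by
  have hmass : ∀ n, ((μs n : Measure V3) univ).toReal = ((μs n).mass : ℝ) := fun n => rfl
  obtain ⟨a, ha, φ₁, hφ₁, hlim⟩ := tendsto_subseq_of_bounded (Metric.isBounded_Icc ρ₁ ρ₂)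
    (x := fun n => ((μs n).mass : ℝ)) (fun n => ⟨(hmass n) ▸ hm1 n, (hmass n) ▸ hm2 n⟩)
  rw [closure_Icc] at ha
  have ha0 : 0 < a := hρ₁.trans_le ha.1
  have hlim' : Tendsto (fun n => (μs (φ₁ n)).mass) atTop (𝓝 (⟨a, ha0.le⟩ : ℝ≥0)) :=
    NNReal.tendsto_coe.1 hlim
  have hM : (0 : ℝ≥0) < ⟨a, ha0.le⟩ := ha0
  have hsub : (Set.range fun k => ((μs ∘ φ₁) k : Measure V3)) ⊆ Set.range fun n => (μs n : Measure V3) := by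
    rintro _ ⟨n, rfl⟩
    exact ⟨φ₁ n, rfl⟩
  obtain ⟨φ₂, hφ₂, μ, -, hμ⟩ :=
    Literature.Geometry.GeometricMeasureTheory.exists_subseq_tendsto_of_isTightMeasureSet
      (μs ∘ φ₁) (htight.subset hsub) hM hlim'
  exact ⟨φ₁ ∘ φ₂, hφ₁.comp hφ₂, μ, hμ⟩

/-- A strictly increasing reparametrisation preserves the tail schedule (`j ≤ n ≤ φ n`). [folklore] -/
theorem tail_schedule_comp {m : ℕ → Measure V3} (Lt : ℕ → ℝ)
    (htail : ∀ n j : ℕ, j ≤ n →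
      ∫ v in {v : V3 | Lt j < ‖v‖}, ‖v‖ ^ 2 ∂(m n) ≤ 1 / ((j : ℝ) + 1))
    {φ : ℕ → ℕ} (hφ : StrictMono φ) :
    ∀ n j : ℕ, j ≤ n →
      ∫ v in {v : V3 | Lt j < ‖v‖}, ‖v‖ ^ 2 ∂(m (φ n)) ≤ 1 / ((j : ℝ) + 1) :=
  fun n j hj => htail (φ n) j (hj.trans (hφ.id_le n))

/-- **Mass window + tail schedule ⇒ weakly convergent subsequence with uniformly integrable second
moments.** For finite measures `mₙ` on `ℝ³` with `|v|²` integrable, masses in `[ρ₁, ρ₂]` (`ρ₁ > 0`)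
and tails `∫_{Lt j<|v|} |v|² dmₙ ≤ 1/(j+1)` for `j ≤ n`, some subsequence converges weakly to a finite
measure, and along it the second moments are uniformly integrable. [folklore] -/
theorem exists_subseq_tendsto_of_mass_le_of_tail (m : ℕ → Measure V3) (hfin : ∀ n, IsFiniteMeasure (m n))
    (h2 : ∀ n, Integrable (fun v : V3 => ‖v‖ ^ 2) (m n)) {ρ₁ ρ₂ : ℝ} (hρ₁ : 0 < ρ₁)
    (hm1 : ∀ n, ρ₁ ≤ ((m n) univ).toReal) (hm2 : ∀ n, ((m n) univ).toReal ≤ ρ₂) (Lt : ℕ → ℝ)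
    (htail : ∀ n j : ℕ, j ≤ n →
      ∫ v in {v : V3 | Lt j < ‖v‖}, ‖v‖ ^ 2 ∂(m n) ≤ 1 / ((j : ℝ) + 1)) :
    ∃ φ : ℕ → ℕ, StrictMono φ ∧ ∃ μ : FiniteMeasure V3,
      Tendsto (β := FiniteMeasure V3) (fun n => ⟨m (φ n), hfin (φ n)⟩) atTop (𝓝 μ) ∧
      (∀ ε : ℝ, 0 < ε → ∃ L : ℝ, ∀ n, ∫ v in {v : V3 | L < ‖v‖}, ‖v‖ ^ 2 ∂(m (φ n)) ≤ ε) := by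
  have htight : IsTightMeasureSet (Set.range m) :=
    isTightMeasureSet_of_ui h2 fun ε hε => exists_ui_of_tail_schedule h2 Lt htail hε
  obtain ⟨φ, hφ, μ, hμ⟩ := exists_subseq_tendsto_of_isTight
    (μs := fun n => (⟨m n, hfin n⟩ : FiniteMeasure V3)) htight hρ₁ hm1 hm2
  exact ⟨φ, hφ, μ, hμ, fun ε hε =>
    exists_ui_of_tail_schedule (fun n => h2 (φ n)) Lt (tail_schedule_comp Lt htail hφ) hε⟩

/-! ## Registered sub-goal -/

/-- **Registered sub-goal `stub_quantitativeRigidityA` (helper A of `stub_quantitativeRigidity`): the second-moment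
tail `∫_{L<|v|} |v|² dm` is non-increasing in the level.** [folklore] -/
theorem stub_quantitativeRigidityA : ∀ {m : Measure V3}, Integrable (fun v : V3 => ‖v‖ ^ 2) m → ∀ {L L' : ℝ}, L ≤ L' → ∫ v in {v : V3 | L' < ‖v‖}, ‖v‖ ^ 2 ∂m ≤ ∫ v in {v : V3 | L < ‖v‖}, ‖v‖ ^ 2 ∂m :=
  fun h2 _ _ hL => setIntegral_sq_tail_anti h2 hL

end Summit.AtomisticToContinuum.HydrodynamicLimit.Theorems.ChaosClosesEulerQuantitativeRigidity

end
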